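import Literature.Probability.Percolation.SlabCircuitCornerSurgery
import Literature.Probability.Percolation.SlabCircuitCornerCrude
import Literature.Probability.Percolation.SlabGluingFact2Reduction
import HarnessLib

/-!
# Newman–Tassion–Wu 2017, Theorem 3.10 — the corner-gluing inequality of the top-right corner

Topic: `Literature/Probability/Percolation`. Eighteenth file of the port of THEOREM 3.10 of
Newman–Tassion–Wu, *Critical percolation and the minimal spanning tree in slabs* (CPAM 70 (2017);
arXiv:1512.09107, pp. 12–14). `CornerGlue₁ k N n p K` (`SlabCircuitSideCrossings.lean`) is NTW's
`P[G ∩ cornerDom₁ ∖ cornerLink₁] ≤ K · P[G ∩ cornerLink₁]` for every bystander `G` determined off the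
corner square. Here it is PROVED with `K = λ_p^{s₁(k)}`, `λ_p = 2/min{p,1-p}`,
`s₁(k) = 3(5k+4)·13²` (written `3 * ((5 * k + 4) * (2 * (2 * 3) + 1) ^ 2)`), uniformly in the hole size `N ≥ 1` and the width `n`:

* `cornerGlue₁_of_le` — widths `n ≥ 4`: the located surgery `exists_surgery_corner₁` (cleared set
  inside the corner square and a ball of radius `3`) is a `GadgetSpec` changing no edge off the
  corner square, and the multi-valued map principle inside a bystander
  (`real_inter_le_of_gadgetsIn_of_determinedBy`) applies;
* `cornerGlue₁_holds` — all widths (the bounded ones by `cornerGlue₁_crude`).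

## Sources

* C. M. Newman, V. Tassion, W. Wu, *Critical percolation and the minimal spanning tree in slabs*,
  Comm. Pure Appl. Math. 70 (2017), arXiv:1512.09107: proof of Theorem 3.10, (3.121)–(3.122), with
  Lemma 3.5 and the proof of Theorem 3.7 [NewmanTassionWu2017].
-/

noncomputable section

namespace Literature.Probability.Percolation

open MeasureTheory LatticeModels SimpleGraph

namespace NTW17

variable {k : ℕ}

/-- `CornerGlue₁` is monotone in the constant. [cite: NewmanTassionWu2017, Theorem 3.10 (proof, (3.121)–(3.122))] -/
theorem cornerGlue₁_mono {N n : ℕ} {p : unitInterval} {K K' : ℝ} (hKK' : K ≤ K')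
    (h : CornerGlue₁ k N n p K) : CornerGlue₁ k N n p K' := fun Ω G hΩ hG hGm =>
  (h Ω G hΩ hG hGm).trans (mul_le_mul_of_nonneg_right hKK' measureReal_nonneg)

/-- **`CornerGlue₁` for widths `n ≥ 4`** with `K = λ_p^{s₁(k)}`: the located corner surgery inside a
bystander event. [cite: NewmanTassionWu2017, Theorem 3.10 (proof, (3.121)–(3.122)) with Lemma 3.5 and Theorem 3.7] -/
theorem cornerGlue₁_of_le (hk : 1 ≤ k) {N n : ℕ} (hn : 4 ≤ n) (p : unitInterval)
    (hp0 : 0 < (p : ℝ)) (hp1 : (p : ℝ) < 1) :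
    CornerGlue₁ k N n p ((2 / min (p : ℝ) (1 - p)) ^ (3 * ((5 * k + 4) * (2 * (2 * 3) + 1) ^ 2))) := by
  intro Ω G hΩ hG hGm
  set Q := cornerQ₁ N n with hQ
  set X : Set (BondConfig (slab 3 k)) :=
    Q.evX k ∩ slabConn k (corR N n) {z | z.2 = -(N : ℤ)} {z | z.2 = (N : ℤ) + n} with hXdef
  have hset : G ∩ cornerDom₁ k N n ∩ (cornerLink₁ k N n)ᶜ = G ∩ X := by
    ext ω
    simp only [hXdef, GlueData.evX, ← cornerQ₁_evAB_inter, Set.mem_inter_iff, Set.mem_compl_iff]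
    tauto
  rw [hset, ← cornerQ₁_evCA N n]
  have hcorR : corR N n ⊆ Q.R := (Set.subset_union_right : corR N n ⊆ domT N n ∪ corR N n)
  have hX : DeterminedBy X (slabLift k Q.R).sym2 :=
    ((determinedBy_slabConn k _ _ Q.hSR).inter (determinedBy_slabConn k _ _ subset_rfl).compl).inter
      (determinedBy_slabConn k _ _ hcorR)
  refine real_inter_le_of_gadgetsIn_of_determinedBy (Q := Q) (r := 3) (D₀ := cornerSq N n 0) p hp0 hp1
    hX hΩ hG hGm ?_
  intro ω hω hωX
  obtain ⟨sx, hsq, z, hz⟩ := exists_surgery_corner₁ hk hn hω hωX.1 hωX.2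
  exact ⟨sx.newConfig, GadgetSpec.of_surgery hωX.1 sx ⟨z, hz⟩,
    fun e he => sx.agree_off_touch fun h => he (touch_mono hsq h)⟩

/-- `λ_p ≥ 1`. [folklore] -/
private theorem one_le_lam (p : unitInterval) (hp0 : 0 < (p : ℝ)) (hp1 : (p : ℝ) < 1) :
    1 ≤ 2 / min (p : ℝ) (1 - p) := by
  rw [le_div_iff₀ (lt_min hp0 (by linarith))]
  have := min_le_left (p : ℝ) (1 - p)
  have := p.2.2
  linarith

/-- **`CornerGlue₁ k N n p λ_p^{s₁(k)}` for every hole size `N ≥ 1` and every width `n`.**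
[cite: NewmanTassionWu2017, Theorem 3.10 (proof, (3.121)–(3.122)) with Lemma 3.5 and Theorem 3.7] -/
theorem cornerGlue₁_holds (hk : 1 ≤ k) {N : ℕ} (hN : 1 ≤ N) (n : ℕ) (p : unitInterval)
    (hp0 : 0 < (p : ℝ)) (hp1 : (p : ℝ) < 1) :
    CornerGlue₁ k N n p ((2 / min (p : ℝ) (1 - p)) ^ (3 * ((5 * k + 4) * (2 * (2 * 3) + 1) ^ 2))) := by
  by_cases hn : 4 ≤ n
  · exact cornerGlue₁_of_le hk hn p hp0 hp1
  · refine cornerGlue₁_mono ?_ (cornerGlue₁_crude (k := k) (n := n) p hp0 hp1 hN)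
    refine pow_le_pow_right₀ (one_le_lam p hp0 hp1) ?_
    have hn3 : n ^ 2 ≤ 9 := by nlinarith
    have h169 : (2 * (2 * 3) + 1) ^ 2 = (169 : ℕ) := by norm_num
    rw [h169]
    nlinarith

end NTW17

end Literature.Probability.Percolation

end
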